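import Mathlib

/-!
# States of the polynomial CCR algebra: quasi-free states, Bogoliubov maps, quasi-free dynamics,
# ground states (local stability)

Topic `MathematicalPhysics/QuantumManyBody`, namespace `Literature.MathematicalPhysics.QuantumManyBody`
with the object sub-namespace `CCR`. Abstract layer (any real vector space `S` of "test vectors" with a
bilinear form `σ`); the phonon model of linearised superfluid hydrodynamics that motivated it is
`QuasiFreePhononState.lean`.

For a pre-symplectic space `(S, σ)` the **polynomial CCR *-algebra** `CCR^pol(S, σ)` is the unital
complex *-algebra generated by symbols `Φ(F)`, `F ∈ S`, with `Φ` real-linear, `Φ(F)* = Φ(F)` and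
`Φ(F)Φ(G) - Φ(G)Φ(F) = i σ(F, G) 1` (Dereziński–Gérard Def. 8.40; Verbeure (2.9): the boson fields,
presentation (ii) of the boson algebra of observables). We realise it WITHOUT a quotient type:
`FieldPolynomial S = ℂ⟨S⟩ := MonoidAlgebra ℂ (FreeMonoid S)` is the free unital complex algebra on
the symbols (a word `F₁⋯Fₙ : FreeMonoid S` is the monomial `Φ(F₁)⋯Φ(Fₙ)`, "polynomials in smeared
fields"), `adjoint` is the conjugate-linear anti-involution reversing words (so `Φ(F)* = Φ(F)` is
built in), and a **state** (`CCR.State σ`; DG Def. 17.9 / Verbeure Def. 2.1: linear, `ω(1) = 1`,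
`ω(A*A) ≥ 0`) is a linear functional on `ℂ⟨S⟩` that is positive, normalised and VANISHES ON THE
TWO-SIDED IDEAL generated by the defining relations (`field_add`, `field_smul`, `ccr`, each stated as
`ω(X r Y) = …` for all `X, Y ∈ ℂ⟨S⟩`). Since that ideal is a *-ideal, these functionals are exactly
the states of the quotient `CCR^pol(S, σ)`; `ω.npoint [F₁, …, Fₙ] = ω(Φ(F₁)⋯Φ(Fₙ))` are the
`n`-point (correlation) functions (Verbeure (2.12)–(2.13)).

* `State.IsQuasiFree` — **quasi-free (Gaussian) state**: all truncated correlation functions of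
  order `n > 2` vanish (Verbeure Def. 2.2; DG Def. 17.10, and the remark opening §17.1 for a non-zero
  one-point function), in the equivalent recursive (Wick) form obtained by expanding the first field,
  `ω(Φ(F)Φ(G₁)⋯Φ(Gₙ)) = ω(Φ(F)) ω(Φ(G₁)⋯Φ(Gₙ)) + ∑ⱼ ω(Φ(F)Φ(Gⱼ))_T ω(Φ(G₁)⋯Φ̂(Gⱼ)⋯Φ(Gₙ))` with
  `ω(Φ(F)Φ(G))_T = ω(Φ(F)Φ(G)) - ω(Φ(F))ω(Φ(G))` (for zero mean and `n + 1 = 2m` this unfolds to DG's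
  sum over pairings `∑_{Pair₂ₘ} ∏ ω(Φ(F_{σ(2j-1)})Φ(F_{σ(2j)}))`). Such a state is determined by
  `mean` and `twoPointT`; `covariance = Re twoPointT` is DG's covariance `η`
  (Prop. 17.4: `ω(Φ(F)Φ(G)) = η(F,G) + (i/2)σ(F,G)`).
* `bogoliubovMap T` (`Φ(F) ↦ Φ(T F)`; DG Prop. 8.41 / Def. 8.42, "Bogoliubov rotation") and
  `bogoliubovShift χ` (`Φ(F) ↦ Φ(F) + χ(F)1`; DG Def. 8.21 "Bogoliubov translation", Verbeure (2.15):
  the canonical transformation `τ_χ`, `τ_χ(W(f)) = e^{iχ(f)}W(f)`): algebra endomorphisms of `ℂ⟨S⟩`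
  from the universal properties of `FreeMonoid`/`MonoidAlgebra`. `State.IsInvariant α ω`.
* `FieldDerivation` — a derivation of `ℂ⟨S⟩` given by its values on generators and the Leibniz rule
  (Verbeure §5.1: `δ(a♯(f₁)⋯a♯(fₙ)) = ∑ⱼ a♯(f₁)⋯δ(a♯(fⱼ))⋯a♯(fₙ)`); `quasiFreeDerivation D c` is the
  one of a (formal, possibly only locally defined) QUADRATIC Hamiltonian, in Verbeure's convention
  `δ = [H, ·]` (no factor `i`; `α_t = exp(itδ)`, (5.2)): if the linear fields obey the Heisenberg
  equation `(d/dt)Φ(F) = Φ(DF) + c(F)1` then `[H, Φ(F)] = -i(Φ(DF) + c(F)1)`.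
* `IsGroundState δ ω` — **ground state / local (energetic) stability**: `ω(A*[H, A])` is real and
  `≥ 0` for all `A` (Verbeure Def. 3.7, the `β → ∞` limit of the energy–entropy balance inequalities;
  Bratteli–Robinson II Def. 5.3.18 in the form `-i ω(A*δ'(A)) ≥ 0`, `δ' = iδ` the generator of
  `τ_t`); `IsGroundStateOn P` asks it only for `A` in the subalgebra generated by the `Φ(F)` with
  `P F` ("for all LOCAL `A`"); `IsStationary` (`ω ∘ δ = 0`; Verbeure Thm 3.8).

Proved API: unfolding lemmas only (`adjoint_single/phi/one/add`, `word_*`, `npoint_nil`,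
`bogoliubovMap_phi/word`, `bogoliubovShift_phi`, `FieldDerivation.apply_single/word/one/phi`).
NOT here (no named facts introduced): existence of quasi-free states with given covariance
(DG Prop. 17.5: iff `|σ(F,G)| ≤ 2 η(F,F)^½ η(G,G)^½`); that `bogoliubovMap`/`bogoliubovShift`
transport states (they do when `T` is `σ`-symplectic); BR II Thm 5.3.19; the Weyl (exponentiated)
form of the CCR, `C*`-completions and regularity; GNS.

Mathlib/tree status (2026-08-15): no CCR/Weyl algebra, bosonic quasi-free state or KMS/ground-state
notion in Mathlib (`lean search 'quasiFree|WeylAlgebra|CCR|KMS'`); the tree has only the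
finite-dimensional fermionic `FreeFermions.QuasiFreeVacuum` and `QuantumLattice.FermionQuasiFree*`
(matrices, unrelated API). `FreeAlgebra`'s `StarRing` instance does not conjugate scalars, whence
`MonoidAlgebra ℂ (FreeMonoid S)` with an explicit `adjoint`. Anchors: `MonoidAlgebra` (one-field
structure: `coeff`, `single`, `of`, `lift`, `mapDomainAlgHom`, `coeffLinearEquiv`), `FreeMonoid`
(`of`, `ofList`, `toList`, `reverse`, `map`, `lift`), `Finsupp.linearCombination`.

## References

* [DerezinskiGerard2022] J. Dereziński, C. Gérard, Mathematics of Quantization and Quantum Fields,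
  CUP: Def. 8.21, Def. 8.40, Prop. 8.41, Def. 8.42, Def. 17.1, Prop. 17.4, Prop. 17.5, Def. 17.9,
  Def. 17.10.
* [Verbeure2011] A. F. Verbeure, Many-Body Boson Systems, Springer 2011: §2.2 (2.8)–(2.11), Def. 2.1,
  (2.12)–(2.13), Def. 2.2, (2.14)–(2.18), Def. 3.7, Thm 3.8, §5.1 (5.2)–(5.4), App. 7.3.
* [BratteliRobinsonII1997] O. Bratteli, D. W. Robinson, Operator Algebras and Quantum Statistical
  Mechanics 2, 2nd ed.: Def. 5.3.18, Thm 5.3.19.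
-/

noncomputable section

open scoped BigOperators ComplexConjugate

namespace Literature.MathematicalPhysics.QuantumManyBody

namespace CCR

variable {S : Type*}

/-! ### The free field algebra `ℂ⟨S⟩`, words, adjoint -/

variable (S) in
/-- The free unital complex algebra `ℂ⟨S⟩` on the field symbols `Φ(F)`, `F ∈ S` ("polynomials in the
smeared fields"): the monoid algebra of the free monoid on `S`, a word `F₁⋯Fₙ` standing for the
monomial `Φ(F₁)⋯Φ(Fₙ)`. The polynomial CCR algebra `CCR^pol(S, σ)` is its quotient by the relations
that `CCR.State` imposes on functionals. [cite: DerezinskiGerard2022, Def. 8.40] -/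
abbrev FieldPolynomial : Type _ := MonoidAlgebra ℂ (FreeMonoid S)

/-- The monomial `Φ(F₁)⋯Φ(Fₙ) ∈ ℂ⟨S⟩` of a list of test vectors (`word [] = 1`). [folklore] -/
def word (l : List S) : FieldPolynomial S :=
  MonoidAlgebra.of ℂ (FreeMonoid S) (FreeMonoid.ofList l)

/-- The field generator `Φ(F) ∈ ℂ⟨S⟩` (Verbeure's boson field `b(f)`, DG's `φ(y)`).
[cite: DerezinskiGerard2022, Def. 8.40] -/
def phi (F : S) : FieldPolynomial S :=
  MonoidAlgebra.of ℂ (FreeMonoid S) (FreeMonoid.of F)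

/-- The empty word is `1`. [folklore] -/
theorem word_nil : word ([] : List S) = 1 := rfl

/-- `Φ(F) · (Φ(G₁)⋯) = Φ(F)Φ(G₁)⋯`. [folklore] -/
theorem word_cons (F : S) (l : List S) : word (F :: l) = phi F * word l := by
  simp [word, phi, FreeMonoid.ofList_cons]

/-- A one-letter word is a field. [folklore] -/
theorem word_singleton (F : S) : word [F] = phi F := rfl

/-- Concatenation of words is multiplication. [folklore] -/
theorem word_append (l l' : List S) : word (l ++ l') = word l * word l' := by
  simp [word, FreeMonoid.ofList_append]

/-- The adjoint `A ↦ A*` of `ℂ⟨S⟩`: conjugate-linear, reverses words, fixes the generators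
(`Φ(F)* = Φ(F)`: the fields are hermitian). [cite: DerezinskiGerard2022, Def. 8.40] -/
def adjoint (A : FieldPolynomial S) : FieldPolynomial S :=
  A.coeff.sum fun w c => MonoidAlgebra.single (FreeMonoid.reverse w) (conj c)

/-- `(c Φ(F₁)⋯Φ(Fₙ))* = c̄ Φ(Fₙ)⋯Φ(F₁)`. [folklore] -/
@[simp] theorem adjoint_single (w : FreeMonoid S) (c : ℂ) :
    adjoint (MonoidAlgebra.single w c) = MonoidAlgebra.single (FreeMonoid.reverse w) (conj c) := by
  simp [adjoint, Finsupp.sum_single_index]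

/-- The fields are hermitian: `Φ(F)* = Φ(F)`. [cite: DerezinskiGerard2022, Def. 8.40] -/
@[simp] theorem adjoint_phi (F : S) : adjoint (phi F) = phi F := by
  simp [phi, MonoidAlgebra.of_apply]

/-- The empty word reversed is the empty word. [folklore] -/
theorem freeMonoid_reverse_one : FreeMonoid.reverse (1 : FreeMonoid S) = 1 := rfl

/-- `1* = 1`. [folklore] -/
@[simp] theorem adjoint_one : adjoint (1 : FieldPolynomial S) = 1 := by
  rw [MonoidAlgebra.one_def, adjoint_single, freeMonoid_reverse_one, map_one]

/-- The adjoint is additive. [folklore] -/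
theorem adjoint_add (A B : FieldPolynomial S) : adjoint (A + B) = adjoint A + adjoint B := by
  unfold adjoint
  rw [MonoidAlgebra.coeff_add, Finsupp.sum_add_index']
  · intro w; simp
  · intro w c₁ c₂; simp [MonoidAlgebra.single_add]

/-! ### Derivations given on generators -/

/-- A **derivation of `ℂ⟨S⟩` given on generators**: `δ(Φ(F)) = onField F`, extended by the Leibniz
rule `δ(Φ(F₁)⋯Φ(Fₙ)) = ∑ⱼ Φ(F₁)⋯δ(Φ(Fⱼ))⋯Φ(Fₙ)` (`FieldDerivation.apply`). The limit derivations
`δ = lim_V [H_V, ·]` of boson systems are of this form. [cite: Verbeure2011, §5.1 (5.2)–(5.3)] -/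
structure FieldDerivation (S : Type*) where
  /-- the value `δ(Φ(F))` on a generator -/
  onField : S → FieldPolynomial S

namespace FieldDerivation

/-- Leibniz extension of `δ` to a monomial, by recursion on the word:
`δ(Φ(F)w) = δ(Φ(F)) w + Φ(F) δ(w)`. [cite: Verbeure2011, §5.1] -/
def onWord (δ : FieldDerivation S) : List S → FieldPolynomial S
  | [] => 0
  | F :: l => δ.onField F * word l + phi F * δ.onWord l

/-- The derivation `δ` as a linear endomorphism of `ℂ⟨S⟩` (linear extension of `onWord`).
[cite: Verbeure2011, §5.1] -/
def apply (δ : FieldDerivation S) : FieldPolynomial S →ₗ[ℂ] FieldPolynomial S :=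
  Finsupp.linearCombination ℂ (fun w => δ.onWord (FreeMonoid.toList w)) ∘ₗ
    (MonoidAlgebra.coeffLinearEquiv ℂ).toLinearMap

/-- `δ` on a scalar multiple of a word. [folklore] -/
theorem apply_single (δ : FieldDerivation S) (w : FreeMonoid S) (c : ℂ) :
    δ.apply (MonoidAlgebra.single w c) = c • δ.onWord (FreeMonoid.toList w) := by
  simp only [apply, LinearMap.comp_apply, LinearEquiv.coe_toLinearMap,
    MonoidAlgebra.coeffLinearEquiv_apply, MonoidAlgebra.coeff_single,
    Finsupp.linearCombination_single]

/-- `δ` on a word is its Leibniz expansion. [folklore] -/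
theorem apply_word (δ : FieldDerivation S) (l : List S) : δ.apply (word l) = δ.onWord l := by
  simp [word, MonoidAlgebra.of_apply, apply_single]

/-- `δ(1) = 0`. [folklore] -/
@[simp] theorem apply_one (δ : FieldDerivation S) : δ.apply 1 = 0 := by
  simpa [word_nil, onWord] using δ.apply_word []

/-- `δ(Φ(F))` is the prescribed generator value. [folklore] -/
@[simp] theorem apply_phi (δ : FieldDerivation S) (F : S) : δ.apply (phi F) = δ.onField F := by
  simpa [word_singleton, onWord, word_nil] using δ.apply_word [F]

end FieldDerivation

/-! ### States, quasi-free states, Bogoliubov maps, ground states -/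

section States

variable [AddCommGroup S] [Module ℝ S]

/-- A **state of the polynomial CCR algebra** `CCR^pol(S, σ)` over the pre-symplectic space `(S, σ)`,
presented on the free algebra `ℂ⟨S⟩ = FieldPolynomial S`: a linear functional `ω` with `ω(1) = 1`,
`ω(A*A) ≥ 0` (real), vanishing on the two-sided ideal generated by the defining relations of `CCR^pol`
(`Φ` real-linear: `field_add`, `field_smul`; the CCR `Φ(F)Φ(G) - Φ(G)Φ(F) = iσ(F,G)1`: `ccr`);
hermiticity `Φ(F)* = Φ(F)` is built into `adjoint`. These are in canonical bijection with the states
(DG Def. 17.9, Verbeure Def. 2.1) of the quotient *-algebra `CCR^pol(S, σ)` (DG Def. 8.40).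
[cite: DerezinskiGerard2022, Def. 8.40 and Def. 17.9] -/
structure State (σ : LinearMap.BilinForm ℝ S) where
  /-- the expectation functional on `ℂ⟨S⟩` -/
  toLinearMap : FieldPolynomial S →ₗ[ℂ] ℂ
  /-- normalisation `ω(1) = 1` -/
  map_one : toLinearMap 1 = 1
  /-- positivity `ω(A*A) ≥ 0`: the real part -/
  nonneg : ∀ A, 0 ≤ (toLinearMap (adjoint A * A)).re
  /-- positivity `ω(A*A) ≥ 0`: it is a real number -/
  im_eq_zero : ∀ A, (toLinearMap (adjoint A * A)).im = 0
  /-- `Φ` is additive: `ω(X Φ(F+G) Y) = ω(X Φ(F) Y) + ω(X Φ(G) Y)` -/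
  field_add : ∀ (X Y : FieldPolynomial S) (F G : S),
    toLinearMap (X * phi (F + G) * Y) = toLinearMap (X * phi F * Y) + toLinearMap (X * phi G * Y)
  /-- `Φ` is real-homogeneous: `ω(X Φ(aF) Y) = a ω(X Φ(F) Y)` -/
  field_smul : ∀ (X Y : FieldPolynomial S) (a : ℝ) (F : S),
    toLinearMap (X * phi (a • F) * Y) = (a : ℂ) * toLinearMap (X * phi F * Y)
  /-- the canonical commutation relations `ω(X [Φ(F), Φ(G)] Y) = i σ(F,G) ω(X Y)` -/
  ccr : ∀ (X Y : FieldPolynomial S) (F G : S),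
    toLinearMap (X * (phi F * phi G - phi G * phi F) * Y) =
      Complex.I * (σ F G : ℂ) * toLinearMap (X * Y)

variable {σ : LinearMap.BilinForm ℝ S}

/-- A state is used as the function `A ↦ ω(A)` on `ℂ⟨S⟩`. [folklore] -/
instance : CoeFun (State σ) fun _ => FieldPolynomial S → ℂ := ⟨fun ω A => ω.toLinearMap A⟩

namespace State

/-- The coercion of a state to a function is its functional. [folklore] -/
theorem coe_apply (ω : State σ) (A : FieldPolynomial S) : ω A = ω.toLinearMap A := rfl

/-- Two states with the same functional are equal. [folklore] -/
@[ext] theorem ext {ω₁ ω₂ : State σ} (h : ∀ A, ω₁ A = ω₂ A) : ω₁ = ω₂ := by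
  cases ω₁; cases ω₂; congr; exact LinearMap.ext h

/-- The `n`-point (correlation) functions `ω(Φ(F₁)⋯Φ(Fₙ))` of a state, on lists of test vectors.
[cite: Verbeure2011, §2.3 (2.12)–(2.13)] -/
def npoint (ω : State σ) (l : List S) : ℂ := ω (word l)

/-- The one-point functional `F ↦ ω(Φ(F))` (a real number for a state; its real part is taken).
[cite: DerezinskiGerard2022, §17.1 (17.3)] -/
def mean (ω : State σ) (F : S) : ℝ := (ω (phi F)).re

/-- The truncated two-point function `ω(Φ(F)Φ(G))_T = ω(Φ(F)Φ(G)) - ω(Φ(F))ω(Φ(G))`.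
[cite: Verbeure2011, §2.3 (2.13)] -/
def twoPointT (ω : State σ) (F G : S) : ℂ := ω (phi F * phi G) - ω (phi F) * ω (phi G)

/-- The covariance `η(F,G) = Re ω(Φ(F)Φ(G))_T` (for a state `ω(Φ(F)Φ(G))_T = η(F,G) + (i/2)σ(F,G)`
with `η` real symmetric, DG Prop. 17.4). [cite: DerezinskiGerard2022, Prop. 17.4] -/
def covariance (ω : State σ) (F G : S) : ℝ := (ω.twoPointT F G).re

/-- `ω()` of the empty product is `1`. [folklore] -/
theorem npoint_nil (ω : State σ) : ω.npoint [] = 1 := by simp [npoint, word_nil, ω.map_one]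

/-- The one-point function. [folklore] -/
theorem npoint_singleton (ω : State σ) (F : S) : ω.npoint [F] = ω (phi F) := rfl

/-- **Quasi-free (Gaussian) state**: all truncated functions of order `> 2` vanish (Verbeure Def. 2.2,
DG Def. 17.10 with a possibly non-zero one-point function), in the equivalent recursive Wick form
obtained by expanding the first field: `ω(Φ(F)Φ(G₁)⋯Φ(Gₙ)) = ω(Φ(F))ω(Φ(G₁)⋯Φ(Gₙ)) +
∑ⱼ ω(Φ(F)Φ(Gⱼ))_T ω(Φ(G₁)⋯Φ̂(Gⱼ)⋯Φ(Gₙ))` (the pair `(F, Gⱼ)` kept in this order).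
[cite: DerezinskiGerard2022, Def. 17.10] -/
def IsQuasiFree (ω : State σ) : Prop :=
  ∀ (F : S) (l : List S), ω.npoint (F :: l) =
    ω (phi F) * ω.npoint l + ∑ j : Fin l.length, ω.twoPointT F (l.get j) * ω.npoint (l.eraseIdx j)

/-- Invariance of a state under an endomorphism `α` of `ℂ⟨S⟩` (`ω ∘ α = ω`). [folklore] -/
def IsInvariant (α : FieldPolynomial S →ₐ[ℂ] FieldPolynomial S) (ω : State σ) : Prop :=
  ∀ A, ω (α A) = ω A

end State

/-- The **Bogoliubov map** (rotation) of `ℂ⟨S⟩` induced by a real-linear `T : S → S`: the algebra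
endomorphism with `Φ(F) ↦ Φ(T F)`; for `σ`-symplectic `T` it descends to the Bogoliubov
automorphism `r̂` of `CCR^pol` (DG Prop. 8.41). [cite: DerezinskiGerard2022, Def. 8.42] -/
def bogoliubovMap (T : S →ₗ[ℝ] S) : FieldPolynomial S →ₐ[ℂ] FieldPolynomial S :=
  MonoidAlgebra.mapDomainAlgHom ℂ ℂ (FreeMonoid.map T)

/-- The **Bogoliubov translation** (field shift; Verbeure's canonical transformation `τ_χ`) by a
real linear functional `χ`: the algebra endomorphism of `ℂ⟨S⟩` with `Φ(F) ↦ Φ(F) + χ(F)1`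
(`τ_χ(W(f)) = e^{iχ(f)} W(f)` on Weyl operators). [cite: Verbeure2011, §2.3 (2.15)] -/
def bogoliubovShift (χ : S →ₗ[ℝ] ℝ) : FieldPolynomial S →ₐ[ℂ] FieldPolynomial S :=
  MonoidAlgebra.lift ℂ (FieldPolynomial S) (FreeMonoid S)
    (FreeMonoid.lift fun F => phi F + algebraMap ℂ (FieldPolynomial S) (χ F))

/-- `bogoliubovMap T (Φ(F)) = Φ(T F)`. [cite: DerezinskiGerard2022, Prop. 8.41] -/
@[simp] theorem bogoliubovMap_phi (T : S →ₗ[ℝ] S) (F : S) : bogoliubovMap T (phi F) = phi (T F) := by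
  simp [bogoliubovMap, phi, MonoidAlgebra.of_apply]

/-- `bogoliubovMap T` acts letterwise on words. [folklore] -/
theorem bogoliubovMap_word (T : S →ₗ[ℝ] S) (l : List S) :
    bogoliubovMap T (word l) = word (l.map T) := by
  simp [bogoliubovMap, word, MonoidAlgebra.of_apply, FreeMonoid.ofList_map]

/-- `bogoliubovShift χ (Φ(F)) = Φ(F) + χ(F)1`. [cite: Verbeure2011, §2.3 (2.15)] -/
@[simp] theorem bogoliubovShift_phi (χ : S →ₗ[ℝ] ℝ) (F : S) :
    bogoliubovShift χ (phi F) = phi F + algebraMap ℂ (FieldPolynomial S) (χ F) := by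
  simp [bogoliubovShift, phi]

/-- The **quasi-free derivation** `δ = [H, ·]` of a formal quadratic Hamiltonian, in Verbeure's
convention (no factor `i`; `α_t = exp(itδ)`): if the linear fields evolve by
`(d/dt)Φ(F) = Φ(DF) + c(F)1` (real-linear one-particle generator `D`, real functional `c` from the
linear terms of `H`), then `[H, Φ(F)] = -i (Φ(DF) + c(F)1)`; e.g. the free Bose gas
`δ(a*(g)) = a*(hg)` (Verbeure (5.4)). [cite: Verbeure2011, §5.1 (5.4)] -/
def quasiFreeDerivation (D : S →ₗ[ℝ] S) (c : S →ₗ[ℝ] ℝ) : FieldDerivation S where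
  onField F := (-Complex.I) • (phi (D F) + algebraMap ℂ (FieldPolynomial S) (c F))

/-- **Ground state (local / energetic stability)** of `ω` for the dynamics `δ = [H, ·]`:
`ω(A* [H, A])` is real and `≥ 0` for every `A ∈ ℂ⟨S⟩` (Verbeure Def. 3.7, the `β → ∞` limit of the
energy–entropy balance criterion; BR II Def. 5.3.18 as `-iω(A*δ'(A)) ≥ 0` for `δ' = iδ`).
[cite: Verbeure2011, Def. 3.7] -/
def IsGroundState (δ : FieldDerivation S) (ω : State σ) : Prop :=
  ∀ A : FieldPolynomial S, 0 ≤ (ω (adjoint A * δ.apply A)).re ∧ (ω (adjoint A * δ.apply A)).im = 0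

/-- The ground-state inequality `ω(A*[H,A]) ≥ 0` required only for `A` in the subalgebra generated by
the `Φ(F)` with `P F` ("for all LOCAL observables `A`"). [cite: Verbeure2011, Def. 3.7] -/
def IsGroundStateOn (P : S → Prop) (δ : FieldDerivation S) (ω : State σ) : Prop :=
  ∀ A : FieldPolynomial S, (∀ w ∈ A.coeff.support, ∀ F ∈ FreeMonoid.toList w, P F) →
    0 ≤ (ω (adjoint A * δ.apply A)).re ∧ (ω (adjoint A * δ.apply A)).im = 0

/-- Stationarity (time invariance) of `ω` under `δ`: `ω([H, X]) = 0` for all `X` (for ground /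
equilibrium states a consequence of the EEB inequalities, Verbeure Thm 3.8).
[cite: Verbeure2011, Thm 3.8] -/
def IsStationary (δ : FieldDerivation S) (ω : State σ) : Prop :=
  ∀ A : FieldPolynomial S, ω (δ.apply A) = 0

/-- A ground state for all observables is one for any class of local observables. [folklore] -/
theorem IsGroundState.isGroundStateOn {δ : FieldDerivation S} {ω : State σ} (h : IsGroundState δ ω)
    (P : S → Prop) : IsGroundStateOn P δ ω := fun A _ => h A

end States

end CCR

end Literature.MathematicalPhysics.QuantumManyBody
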